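import Mathlib.Topology.MetricSpace.HolderNorm
import Mathlib.Order.Filter.AtTopBot.Basic
import Mathlib.Algebra.Ring.Periodic
import Literature.Analysis.FluidPDE.PassiveScalar
import Literature.Analysis.FunctionSpaces.HolderNorm
import Literature.Analysis.FunctionSpaces.TorusSobolevNorm
import HarnessLib

-- provenance: harness21/H21/H21/Statements/Turb/PassiveScalar.lean @ 4713b10 (interim HEAD d8f2665); M5 mechanical rewrite
/-!
# Anomalous dissipation for passive scalars (family: Turb, statements turb.S21–S22)

Target statements on anomalous dissipation / anomalous diffusion for the passive scalar equation
`∂ₜθ + u·∇θ = κ Δθ` on the flat torus `T^d = UnitAddTorus d`, `d ≥ 2`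
(`H21/Outlines/FluidKinetic.md`, item TurbPassiveScalar):

* **turb.S21** `deij_anomalous_dissipation`: Drivas–Elgindi–Iyer–Jeong, Arch. Ration. Mech.
  Anal. 243 (2022), Thm. 2 ("data dependent rate and velocity field") — for every mean-zero
  `H²` datum `θ₀` a divergence-free field
  `u = u(θ₀) ∈ C^∞([0,T) × T^d) ∩ L¹([0,T]; C^α(T^d)) ∩ L^∞([0,T] × T^d)` (`α < 1` fixed in
  advance) and a rate `c = χ_α(θ₀) > 0` with `κ ∫₀ᵀ ‖∇θ^κ‖²_{L²} ≥ c ‖θ₀‖²_{L²}`, in the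
  inventory's `limsup_{κ → 0}` form, together with the stronger "for all sufficiently small `κ`"
  reading that DEIJ's proof gives, `deij_anomalous_dissipation_eventually`. DEIJ Thm. 1 (one
  field and absolute constants for all data `L²`-close to a harmonic) is not vendored.
  **Corrected 2026-08-16 (verdict clean-up).** The M5 transcription of both turb.S21 facts had
  one field and one rate for *all* mean-zero `H²` data (`∃ u, ∃ c > 0, ∀ θ₀`) and
  `u ∈ L¹_t C^β_x` for *every* `β < 1`; that is not DEIJ's theorem (Thm. 1: universal field and
  rate only for data near harmonics; Thm. 2: field and rate depend on the datum; regularity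
  `L¹_t C^α_x` for the fixed `α`) nor anyone else's (see the docstring), so it was not citable;
  the quantifiers and the regularity are now those printed in DEIJ Thm. 2, names kept (no users).
* **turb.S22** `armstrong_vicol`: Armstrong–Vicol, Ann. PDE 11 (2025), Thm. 1.1 with (1.6) — a
  time-periodic `C⁰_t C^α_x` (`0 < α < 1/3`) divergence-free field and a sequence `κⱼ → 0`, not
  depending on the datum, along which *all* mean-zero `H¹` data dissipate anomalously,
  `κⱼ ∫₀¹ ‖∇θ^{κⱼ}‖² ≥ c ‖θ₀‖²` for every `j`, the rate `c = c(d, α, R) > 0` being uniform over the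
  data with `‖∇θ₀‖²_{L²} ≤ R ‖θ₀‖²_{L²}` (AV: `ϱ` "depends only on `d` and a lower bound for the
  length scale `‖θ₀‖_{L²} / ‖∇θ₀‖_{L²}`"); per-datum corollary `armstrong_vicol_eventually`
  (`∀ θ₀, ∃ c(θ₀) > 0`; the implication is `armstrong_vicol_eventually_of_armstrong_vicol` in
  `TurbPassiveScalarProofs.lean`).
  **Corrected 2026-08-16 (verdict clean-up).** The M5 transcription of both turb.S22 facts put
  `∃ c > 0` *before* `∀ R` (resp. before `∀ θ₀`): one rate for all length scales of the datum.
  The source proves no such uniformity — its `ϱ(d, θ₀)` of (1.6) degenerates with the length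
  scale, and a datum-independent `ϱ` is only *announced* (AV §1.3, for forthcoming work with
  Rowan; still described as future work in the authors' 2025 overview, arXiv:2503.11744, §4.1) —
  so those versions were not dischargeable from any published proof. The quantifiers are now the
  printed ones (`∀ R, ∃ c`, resp. `∀ θ₀, ∃ c`), `0 < α` is required as in AV, and the names are
  kept (same theorem, same users).
* **turb.S22, printed form** `ArmstrongVicol2025_thm11_full` (added 2026-08-26): the same
  Thm. 1.1 with the two printed clauses `armstrong_vicol` drops — the time regularity
  `u ∈ C^{0,α}_t C⁰_x` of (1.3) (and time period `1`) and the lower bound for *every*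
  `κ ∈ ⋃ⱼ [κⱼ/2, 2κⱼ]` (disjoint intervals, remark after (1.6), = the set `K` of (3.43)) — over
  the clause predicates `ArmstrongVicol2025.IsCarrier` / `.DissipatesAlongIntervals`; and
  `ArmstrongVicol2025_rmk54`: the same `u`, `κⱼ` with, in addition, Remark 5.4 —
  `‖θ^κ‖_{C^{0,μ}([0,1];L²)} ≤ C(θ₀)` for those `κ`, one `μ > 0` ("the diffusive anomaly does not
  happen at any single blow-up time"), clause predicate `.IsTimeHolderAlong`. Corollaries
  `armstrong_vicol_of_thm11_full`, `thm11_full_of_rmk54` in `TurbPassiveScalarProofs.lean`.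
* **turb.S22, explicit rate** `ArmstrongVicol2025_thm11_rate` (added 2026-08-26): Thm. 1.1 with
  the printed power law (1.6), `ϱ = c (‖θ₀‖_{L²}/‖θ₀‖_{H¹})^{(1+α)/(1-α)+ε}` with ONE `c > 0` for
  all mean-zero `H¹` data, every `ε > 0` (carrier, intervals and `c` depending on `ε` through the
  scale-separation parameter `q` of (2.2), as in the proof, p. 93) — clause predicate
  `ArmstrongVicol2025.DissipatesAtRate p u κ`; it implies the class-uniform clause of
  `ArmstrongVicol2025_thm11_full` (`ArmstrongVicol2025.DissipatesAtRate.dissipatesAlongIntervals`,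
  `thm11_full_of_thm11_rate` in `TurbPassiveScalarProofs.lean`).

## Design choices

* Everything is phrased with the accepted F14 notions of `Literature.Analysis.FluidPDE.PassiveScalar`:
  weak solutions `Torus.IsWeakScalarTransportOn T κ u θ₀ θ` on `T^d × [0,T)` and the spectral
  (total, `ℝ≥0∞`-valued) cumulative dissipation `Torus.eScalarDissipation κ θ 0 T =
  κ ∫₀ᵀ ‖∇θ(t)‖²_{L²} dt`; `‖θ₀‖²_{L²}` is `Torus.scalarL2Sq θ₀` throughout and `‖∇θ₀‖²_{L²}` is
  the spectral `Torus.eScalarGradNormSq θ₀`. For the velocity fields in question (bounded, resp.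
  smooth before the final time) and `κ > 0` the weak solution with datum `θ₀ ∈ L²` exists and is
  unique (`Torus.exists_isWeakScalarTransportOn`, `Torus.IsWeakScalarTransportOn.energy_ineq`,
  `Torus.IsWeakScalarTransportOn.unique_of_lipschitz` on every `[0,T')`, `T' < T`, for the DEIJ
  field; for the bounded, spatially only Hölder field of Armstrong–Vicol uniqueness of
  `L^∞_t L²_x` weak solutions for `κ > 0` is the classical energy argument for bounded
  divergence-free drifts, not recorded in the tree), so the statements quantify over *all* weak
  solutions `θ` instead of naming "the" solution `θ^κ`; the `∀ θ` form is not vacuous.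
* `κ → 0` is discretised along sequences `κ : ℕ → ℝ`, `0 < κ j`, `κ j → 0`.
  "`limsup_{κ → 0} D(κ) ≥ c`" is rendered as: *there exists* a null sequence `κⱼ` along which
  eventually `D(κⱼ) ≥ c` (`limsup ≥ 2c` yields such a sequence; the factor is absorbed in `∃ c`);
  "for all sufficiently small `κ`" as: for *every* null sequence, eventually.
* Regularity classes: `H^s(T^d)` data via `Torus.MemSobolev s` applied to the complexified scalar
  `fun x => (θ₀ x : ℂ)` (the Sobolev scale of G03 is over `ℂ`; this is the same hand
  complexification used by `Torus.eScalarGradNormSq`, so the vector version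
  `Literature.Analysis.FunctionSpaces.Complexify` is not imported), mean zero via
  `Torus.HasZeroMean`; Hölder classes in space
  via the G03 space–time classes `ContinuousInHolderOn` (`C⁰_t C^α_x`) and `MemLpHolder 1 β`
  (`L¹_t C^β_x`) of `Literature.Analysis.FunctionSpaces.HolderNorm`, for the intrinsic sup metric of
  `UnitAddTorus d = d → AddCircle 1` (bi-Lipschitz to the flat metric). Mathlib's
  `Mathlib.Topology.MetricSpace.HolderNorm` supplies the underlying `MemHolder`/`eHolderNorm`;
  time-periodicity is Mathlib's `Function.Periodic`; Hölder continuity *in time* (AV (1.3),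
  `C^{0,α}_t C⁰_x`, and Remark 5.4, `C^{0,μ}_t L²_x`) is Mathlib's `HolderWith` in `t` uniformly
  in `x`, resp. the squared `L²` increments `Torus.scalarL2Sq (θ t - θ s) ≤ C² |t-s|^{2μ}`. No
  notion is defined in this file except the three clause predicates `ArmstrongVicol2025.IsCarrier`,
  `.DissipatesAlongIntervals`, `.IsTimeHolderAlong` (2026-08-26) that spell out the printed form
  of AV Thm. 1.1, so that its two facts and the routes transposing the construction share one text.
* Dimension: a finite index type `d` (implicit) with `2 ≤ Fintype.card d` (both sources work on
  `T^d`, `d ≥ 2`).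

## References

* T. D. Drivas, T. M. Elgindi, G. Iyer, I.-J. Jeong, *Anomalous dissipation in passive scalar
  transport*, Arch. Ration. Mech. Anal. 243 (2022), 1151–1180 (doi:10.1007/s00205-021-01736-2;
  arXiv:1911.03271), Thms. 1–2, (1.3)–(1.5), Prop. 1.3, §3.4, Remark 3.1.
* T. M. Elgindi, K. Liss, *Norm growth, non-uniqueness, and anomalous dissipation in passive
  scalars*, Arch. Ration. Mech. Anal. 248 (2024) (arXiv:2309.08576), Thm. 1 and Remark 1.2
  (comparison only).
* M. Colombo, G. Crippa, M. Sorella, *Anomalous dissipation and lack of selection in the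
  Obukhov–Corrsin theory of scalar turbulence*, Ann. PDE 9 (2023).
* S. Armstrong, V. Vicol, *Anomalous diffusion by fractal homogenization*, Ann. PDE 11 (2025),
  no. 1, Paper No. 2 (doi:10.1007/s40818-024-00189-6; arXiv:2305.05048), Thm. 1.1, (1.6) and the
  remark following (1.6); §1.2 (general `d`), §1.3 (announced uniform estimates), §2.2
  (periodicity of the construction); arXiv v3 (9 Oct 2024) pagination: Thm. 1.1 (1.3)–(1.6) and
  the remarks p. 3, §2.1 (2.1)–(2.2) p. 18, §2.2 p. 23, Cor. 2.3 p. 29, (3.43) p. 43, §5.3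
  p. 82, Remarks 5.3–5.4 pp. 89, 93, §5.4 (proof of Thm. 1.1, (5.103)) pp. 91–93, Prop. 5.5 p. 93.
* S. Armstrong, V. Vicol, *Anomalous diffusion via iterative quantitative homogenization: an
  overview of the main ideas*, arXiv:2503.11744 (2025), Thm. 1.2 and §4.1.
-/

open MeasureTheory Set Filter Topology
open scoped ENNReal NNReal

namespace Literature.Analysis.FluidPDE

variable {d : Type*} [Fintype d] [DecidableEq d]

/-- **turb.S21** (anomalous dissipation for passive scalars; Drivas–Elgindi–Iyer–Jeong, Arch.
Ration. Mech. Anal. 243 (2022), Thm. 2 "Data dependent rate and velocity field"; see also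
Colombo–Crippa–Sorella, Ann. PDE 9 (2023)). Inventory (`limsup`) form.
Let `d ≥ 2`, `α < 1`, `T > 0`, and let `θ₀ ∈ H²(T^d)` have zero mean. There are a velocity field
`u = u(θ₀) : [0,T) × T^d → ℝ^d` — jointly smooth and divergence free on `[0,T) × T^d`, in
`L¹((0,T); C^{0,α}(T^d))`, bounded on `[0,T) × T^d` (`u` becomes singular only at `t = T`), and
continuous in time with values in `C^{0,α}` on `[0,T)` (a consequence of the joint smoothness,
kept from the inventory wording `u ∈ C^∞([0,T); C^α)`) — and a rate `c = χ_α(θ₀) > 0` such that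
`limsup_{κ → 0} κ ∫₀ᵀ ‖∇θ^κ(t)‖²_{L²} dt ≥ c ‖θ₀‖²_{L²}`; precisely: there is a sequence of
diffusivities `κⱼ > 0`, `κⱼ → 0` such that for all weak solutions `θⱼ` of `∂ₜθ + u·∇θ = κⱼ Δθ`,
`θ(0) = θ₀` on `[0,T)`, eventually `c ‖θ₀‖²_{L²} ≤ κⱼ ∫₀ᵀ ‖∇θⱼ‖²_{L²}`.
Source form. DEIJ Thm. 2: "Fix `T > 0`, `d ≥ 2`, `α ∈ [0,1)`, and a mean-zero `θ₀ ∈ H²(T^d)`.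
There exists a divergence-free velocity field
`u ∈ C^∞([0,T) × T^d) ∩ L¹([0,T]; C^α(T^d)) ∩ L^∞([0,T] × T^d)` and `χ_α(θ₀) > 0` so that
`κ ∫₀ᵀ |∇θ^κ|²_{L²} dt ≥ χ_α(θ₀) |θ₀|²_{L²}`" (the proof, §3.4 through the criterion Prop. 1.3,
gives this for all sufficiently small `κ > 0`; that reading is
`deij_anomalous_dissipation_eventually`, which implies the present `limsup` form; the field is
built as alternating sawtooth shears, `W^{2,∞}` in space, with the smooth modification of
Remark 3.1). DEIJ Thm. 1 ("universal rate near harmonics": one field and absolute constants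
`ε_α, χ_α` serving every mean-zero `H²` datum within `ε_α ‖θ₀‖_{L²}` in `L²` of a multiple of a
product harmonic `sin(Mx) sin(Ly)`, `sin(Mx) cos(Ly)`, …) is not vendored here. For this `u`
(Lipschitz on every `[0,T'] × T^d`, `T' < T`) the weak solution with datum `θ₀` is unique on
`[0,T)`, so quantifying over all weak solutions renders DEIJ's `θ^κ`.
**Correction (verdict clean-up, 2026-08-16).** The M5 transcription read `∃ u, ∃ c > 0, ∀ θ₀`
(one field and one rate for *all* mean-zero `H²` data) with `u ∈ L¹_t C^β_x` for *every*
`β < 1`. No published theorem says this: in DEIJ the universal field and rate of Thm. 1 serve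
only data near harmonics, the all-data statement (Thm. 2) has field and rate depending on the
datum, and the field is in `L¹([0,T]; C^α)` for the `α < 1` fixed in advance (the abstract's
`L¹([0,T]; C^{1-})`); the later all-data constructions do not give it either (Elgindi–Liss,
Arch. Ration. Mech. Anal. 248 (2024), Thm. 1 and Remark 1.2: one field, uniformly `C^α` in time
for every `α < 1` but only Lipschitz in space, dissipated fraction depending on the datum;
Armstrong–Vicol 2025: `armstrong_vicol` below). The quantifiers are now those of DEIJ Thm. 2
(`∀ θ₀, ∃ u, ∃ c`) and the regularity is the printed one (joint smoothness before `T`,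
`L¹_t C^α_x`, boundedness); name kept (no users in the tree). [cite: DrivasEtAl2022, Thm. 2] -/
def deij_anomalous_dissipation : Prop :=
  ∀ (hd : 2 ≤ Fintype.card d) (α : ℝ≥0) (hα : α < 1) (T : ℝ) (hT : 0 < T)
    (θ₀ : UnitAddTorus d → ℝ), FunctionSpaces.Torus.MemSobolev 2 (fun x => (θ₀ x : ℂ)) →
    FunctionSpaces.Torus.HasZeroMean θ₀ →
    ∃ u : ℝ → UnitAddTorus d → EuclideanSpace ℝ d,
      FunctionSpaces.Torus.IsSmoothSpaceTimeOn (Ico 0 T) u ∧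
      (∀ t ∈ Ico 0 T, FunctionSpaces.Torus.IsDivFree (u t)) ∧
      FunctionSpaces.ContinuousInHolderOn (Ico 0 T) α u ∧
      FunctionSpaces.MemLpHolder 1 α u (Ioo 0 T) ∧
      (∃ C : ℝ, ∀ t ∈ Ico 0 T, ∀ x, ‖u t x‖ ≤ C) ∧
      ∃ c : ℝ, 0 < c ∧
        ∃ κ : ℕ → ℝ, (∀ j, 0 < κ j) ∧ Tendsto κ atTop (𝓝 0) ∧
        ∀ θ : ℕ → ℝ → UnitAddTorus d → ℝ,
          (∀ j, Torus.IsWeakScalarTransportOn T (κ j) u θ₀ (θ j)) →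
          ∀ᶠ j in atTop, ENNReal.ofReal (c * Torus.scalarL2Sq θ₀) ≤
            Torus.eScalarDissipation (κ j) (θ j) 0 T

/-- **turb.S21** (anomalous dissipation for passive scalars, "all sufficiently small `κ`" form;
Drivas–Elgindi–Iyer–Jeong, Arch. Ration. Mech. Anal. 243 (2022), Thm. 2 with its proof, §3.4
and Prop. 1.3).
With `d`, `α`, `T`, the mean-zero datum `θ₀ ∈ H²(T^d)` and then `u = u(θ₀)`, `c = χ_α(θ₀) > 0`
as in `deij_anomalous_dissipation`: for *every* sequence `κⱼ > 0`, `κⱼ → 0`, and all weak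
solutions `θⱼ` with diffusivity `κⱼ` and datum `θ₀` on `[0,T)`, eventually
`c ‖θ₀‖²_{L²} ≤ κⱼ ∫₀ᵀ ‖∇θⱼ‖²_{L²}` — i.e. the lower bound holds for all sufficiently small
`κ > 0`, the threshold depending on `θ₀`. This is the reading of DEIJ (1.5),
`κ ∫₀ᵀ |∇θ^κ|²_{L²} dt ≥ χ_α(θ₀) |θ₀|²_{L²}`, that the proof establishes ("for sufficiently small
`κ > 0`", proof of Prop. 1.3); it implies the `limsup` form `deij_anomalous_dissipation`.
**Correction (verdict clean-up, 2026-08-16).** As for `deij_anomalous_dissipation`: the M5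
transcription had one field and one rate for all mean-zero `H²` data (`∃ u, ∃ c, ∀ θ₀`) and
`u ∈ L¹_t C^β_x` for every `β < 1`, which is not DEIJ's theorem; now `∀ θ₀, ∃ u, ∃ c` with the
printed regularity. [cite: DrivasEtAl2022, Thm. 2] -/
def deij_anomalous_dissipation_eventually : Prop :=
  ∀ (hd : 2 ≤ Fintype.card d) (α : ℝ≥0) (hα : α < 1) (T : ℝ) (hT : 0 < T)
    (θ₀ : UnitAddTorus d → ℝ), FunctionSpaces.Torus.MemSobolev 2 (fun x => (θ₀ x : ℂ)) →
    FunctionSpaces.Torus.HasZeroMean θ₀ →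
    ∃ u : ℝ → UnitAddTorus d → EuclideanSpace ℝ d,
      FunctionSpaces.Torus.IsSmoothSpaceTimeOn (Ico 0 T) u ∧
      (∀ t ∈ Ico 0 T, FunctionSpaces.Torus.IsDivFree (u t)) ∧
      FunctionSpaces.ContinuousInHolderOn (Ico 0 T) α u ∧
      FunctionSpaces.MemLpHolder 1 α u (Ioo 0 T) ∧
      (∃ C : ℝ, ∀ t ∈ Ico 0 T, ∀ x, ‖u t x‖ ≤ C) ∧
      ∃ c : ℝ, 0 < c ∧
        ∀ κ : ℕ → ℝ, (∀ j, 0 < κ j) → Tendsto κ atTop (𝓝 0) →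
        ∀ θ : ℕ → ℝ → UnitAddTorus d → ℝ,
          (∀ j, Torus.IsWeakScalarTransportOn T (κ j) u θ₀ (θ j)) →
          ∀ᶠ j in atTop, ENNReal.ofReal (c * Torus.scalarL2Sq θ₀) ≤
            Torus.eScalarDissipation (κ j) (θ j) 0 T

/-- **turb.S22** (anomalous diffusion by fractal homogenisation; Armstrong–Vicol, Ann. PDE 11
(2025), Thm. 1.1 with (1.6) and the remark following it, arXiv:2305.05048; the same statement is
Thm. 1.2 of the authors' overview, arXiv:2503.11744).
Let `d ≥ 2` and `0 < α < 1/3`. There are a velocity field `u : ℝ × T^d → ℝ^d` — periodic in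
time, continuous in time with values in `C^{0,α}(T^d)` (`u ∈ C⁰_t C^α_x`) and weakly divergence
free at every time — and a sequence of diffusivities `κⱼ > 0`, `κⱼ → 0`, *not depending on the
datum*, such that for every `R ≥ 0` there is a constant `c = c(d, α, R) > 0` with: for every `j`,
every mean-zero `θ₀ ∈ H¹(T^d)` with `‖∇θ₀‖²_{L²} ≤ R ‖θ₀‖²_{L²}` and every weak solution `θ` of
`∂ₜθ + u·∇θ = κⱼ Δθ`, `θ(0) = θ₀` on `[0,1)` satisfy `c ‖θ₀‖²_{L²} ≤ κⱼ ∫₀¹ ‖∇θ(t)‖²_{L²} dt`.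
Source form. AV Thm. 1.1: for their field `b ∈ C⁰_t C^{0,α}_x ∩ C^{0,α}_t C⁰_x` on
`[0,1] × T^d` with `∇·b(t,·) = 0`, and every mean-zero `θ₀ ∈ H¹(T^d)`, the unique solutions `θ^κ`
satisfy `limsup_{κ → 0} κ ‖∇θ^κ‖²_{L²((0,1)×T^d)} ≥ ϱ² ‖θ₀‖²_{L²}` "for some constant
`ϱ = ϱ(d, θ₀) ∈ (0,1]` which depends only on `d` and the ratio `‖θ₀‖_{L²} / ‖∇θ₀‖_{L²}`"; by (1.6)
`ϱ(d, θ₀) = c(d, ε) (‖θ₀‖_{L²} / ‖θ₀‖_{H¹})^{(1+α)/(1-α)+ε}`, so "`ϱ` depends only on `d` and a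
lower bound for the length scale `‖θ₀‖_{L²} / ‖∇θ₀‖_{L²}`"; and (remark after (1.6)) a subsequence
`κⱼ → 0` realising the bound "is given explicitly in the proof and, in particular, does not
depend on `θ₀`": `inf_{κ ∈ I} κ ‖∇θ^κ‖²_{L²((0,1)×T^d)} ≥ ϱ² ‖θ₀‖²_{L²}` for `I = ⋃ⱼ [κⱼ/2, 2κⱼ]`.
On the class `‖∇θ₀‖² ≤ R ‖θ₀‖²` the ratio `‖θ₀‖_{L²} / ‖θ₀‖_{H¹}` is bounded below in terms of
`R` alone (by `(1+R)^{-1/2}` for `‖θ₀‖²_{H¹} = ‖θ₀‖²_{L²} + ‖∇θ₀‖²_{L²}`), whence one constant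
`c = ϱ²` for the whole class and all `j`; only the centres `κⱼ` of the intervals are kept here
(weaker). The time-periodicity (period `1`; `∃ τ > 0` here) is that of
the construction (AV §2.2: the stream functions `φ_m` and fields `b_m` are periodic in `t` and
`x` with period `1`); the extra `C^{0,α}_t C⁰_x` regularity is dropped; general `d ≥ 2` as in AV
(proof written out for `d = 2`, "only notational differences" in general, AV §1.2). For this
bounded divergence-free `u` and `κ > 0` the `L^∞_t L²_x` weak solution with datum `θ₀` is unique
(energy argument), so quantifying over all weak solutions `θ` renders AV's `θ^κ`.
`‖θ₀‖²_{L²} = Torus.scalarL2Sq θ₀`; `‖∇θ₀‖²_{L²}` is the spectral `Torus.eScalarGradNormSq θ₀`.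
**Correction (verdict clean-up, 2026-08-16).** The M5 transcription read
`∃ c > 0, ∀ R, ∀ᶠ j, …`, one rate for all length scales. AV prove no such uniformity (`ϱ → 0`
with the length scale; a datum-independent `ϱ` is only announced, AV §1.3), so that version was
not dischargeable from the source; the quantifiers are now the printed `∀ R, ∃ c > 0, ∀ j`, and
`0 < α` is required as in AV; name and users unchanged. [cite: ArmstrongVicol2025, Thm. 1.1 with eq. 1.6 and the remark following it] -/
def armstrong_vicol : Prop :=
  ∀ (hd : 2 ≤ Fintype.card d) (α : ℝ≥0) (hα₀ : 0 < α) (hα : α < 1 / 3),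
    ∃ u : ℝ → UnitAddTorus d → EuclideanSpace ℝ d,
      (∃ τ : ℝ, 0 < τ ∧ Function.Periodic u τ) ∧ FunctionSpaces.ContinuousInHolderOn univ α u ∧
      (∀ t, FunctionSpaces.Torus.IsWeaklyDivFree (u t)) ∧
      ∃ κ : ℕ → ℝ, (∀ j, 0 < κ j) ∧ Tendsto κ atTop (𝓝 0) ∧
      ∀ R : ℝ≥0, ∃ c : ℝ, 0 < c ∧ ∀ j, ∀ θ₀ : UnitAddTorus d → ℝ,
        FunctionSpaces.Torus.MemSobolev 1 (fun x => (θ₀ x : ℂ)) → FunctionSpaces.Torus.HasZeroMean θ₀ →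
        Torus.eScalarGradNormSq θ₀ ≤ (R : ℝ≥0∞) * ENNReal.ofReal (Torus.scalarL2Sq θ₀) →
        ∀ θ : ℝ → UnitAddTorus d → ℝ, Torus.IsWeakScalarTransportOn 1 (κ j) u θ₀ θ →
          ENNReal.ofReal (c * Torus.scalarL2Sq θ₀) ≤ Torus.eScalarDissipation (κ j) θ 0 1

/-- **turb.S22** (per-datum form; Armstrong–Vicol, Ann. PDE 11 (2025), Thm. 1.1, consequence).
With `u` and the datum-independent sequence `κⱼ → 0` as in `armstrong_vicol`: for every
mean-zero `θ₀ ∈ H¹(T^d)` there is a constant `c = c(θ₀) > 0` (AV's `ϱ(d, θ₀)²`) such that for all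
sufficiently large `j` (in AV: for all `j`) every weak solution `θ` of the passive scalar equation
with diffusivity `κⱼ` and datum `θ₀` on `[0,1)` satisfies `c ‖θ₀‖²_{L²} ≤ κⱼ ∫₀¹ ‖∇θ‖²_{L²}`; in
particular `liminf_j κⱼ ∫₀¹ ‖∇θ^{κⱼ}‖² > 0` for `θ₀ ≠ 0` (anomalous diffusion of all `H¹` data
along one sequence). Follows from `armstrong_vicol` with `R = ‖∇θ₀‖² / ‖θ₀‖²` (finite for
`θ₀ ∈ H¹`; `θ₀ = 0` is trivial): `armstrong_vicol_eventually_of_armstrong_vicol` in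
`TurbPassiveScalarProofs.lean`.
**Correction (verdict clean-up, 2026-08-16).** The M5 transcription read `∃ c > 0, ∀ θ₀, …`
(a rate uniform in the datum), which AV do not prove (`ϱ = ϱ(d, θ₀)`, Thm. 1.1); the quantifiers
are now the printed `∀ θ₀, ∃ c > 0`, and `0 < α` is required as in AV. [cite: ArmstrongVicol2025, Thm. 1.1] -/
def armstrong_vicol_eventually : Prop :=
  ∀ (hd : 2 ≤ Fintype.card d) (α : ℝ≥0) (hα₀ : 0 < α) (hα : α < 1 / 3),
    ∃ u : ℝ → UnitAddTorus d → EuclideanSpace ℝ d,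
      (∃ τ : ℝ, 0 < τ ∧ Function.Periodic u τ) ∧ FunctionSpaces.ContinuousInHolderOn univ α u ∧
      (∀ t, FunctionSpaces.Torus.IsWeaklyDivFree (u t)) ∧
      ∃ κ : ℕ → ℝ, (∀ j, 0 < κ j) ∧ Tendsto κ atTop (𝓝 0) ∧
      ∀ θ₀ : UnitAddTorus d → ℝ,
        FunctionSpaces.Torus.MemSobolev 1 (fun x => (θ₀ x : ℂ)) → FunctionSpaces.Torus.HasZeroMean θ₀ →
        ∃ c : ℝ, 0 < c ∧ ∀ᶠ j in atTop, ∀ θ : ℝ → UnitAddTorus d → ℝ,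
          Torus.IsWeakScalarTransportOn 1 (κ j) u θ₀ θ →
          ENNReal.ofReal (c * Torus.scalarL2Sq θ₀) ≤ Torus.eScalarDissipation (κ j) θ 0 1

/-! ## Armstrong–Vicol, Thm. 1.1 in its printed form (2026-08-26)

The three clause predicates below spell out Thm. 1.1 of Armstrong–Vicol (Ann. PDE 11 (2025) =
arXiv:2305.05048v3, p. 3) with the remarks following it and Remark 5.4 (p. 93); the facts
`ArmstrongVicol2025_thm11_full` and `ArmstrongVicol2025_rmk54` assert the existence of a carrier
`u` and a lacunary sequence `κⱼ` satisfying them. `armstrong_vicol` above is the corollary keeping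
`C⁰_t C^{0,α}_x`, some period and the interval centres (`armstrong_vicol_of_thm11_full` in
`TurbPassiveScalarProofs.lean`). -/

namespace ArmstrongVicol2025

/-- **The carrier class of AV Thm. 1.1, (1.2)–(1.3)** for an exponent `α`: a velocity field
`u : ℝ × T^d → ℝ^d` which is `1`-periodic in time (§2.2 p. 23: "`φ_m` and `b_m` are
`ℤ × ℤ²`–periodic", `b = ∇^⊥φ = lim b_m`, (2.38)), continuous in time with values in
`C^{0,α}(T^d)` on all of `ℝ` (`u ∈ C⁰_t C^{0,α}_x`), `α`-Hölder in time uniformly in `x`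
(`u ∈ C^{0,α}_t C⁰_x`: one constant `C` with `|u(t,x) - u(s,x)| ≤ C|t-s|^α` for all `s, t, x`),
and weakly divergence free at every time ((1.2)). (1.3) prints
`b ∈ C⁰_t C^{0,α}_x([0,1] × T^d) ∩ C^{0,α}_t C⁰_x([0,1] × T^d)`; on `ℝ` this is the same class by
the time-periodicity, and Cor. 2.3 (p. 29) gives it on `ℝ` directly ("`b` belongs to
`C⁰(ℝ; C^{0,β₁}(ℝ²)) ∩ C^{0,β₁}(ℝ; L^∞(ℝ²))`").
[cite: ArmstrongVicol2025, Thm. 1.1 (1.2)–(1.3) p. 3; §2.2 p. 23; Cor. 2.3 p. 29] -/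
def IsCarrier (α : ℝ≥0) (u : ℝ → UnitAddTorus d → EuclideanSpace ℝ d) : Prop :=
  Function.Periodic u 1 ∧ FunctionSpaces.ContinuousInHolderOn univ α u ∧
    (∃ C : ℝ≥0, ∀ x, HolderWith C α (fun t : ℝ => u t x)) ∧
    ∀ t, FunctionSpaces.Torus.IsWeaklyDivFree (u t)

/-- **The conclusion of AV Thm. 1.1 along the disjoint intervals `Iⱼ = [κⱼ/2, 2κⱼ]`** ((1.4) with
(1.6) and the remark following it, p. 3: "Our arguments exhibit an explicit subsequence `κⱼ → 0`
along which the lower bound in (1.4) is realized, which, in particular, does not depend on `θ₀`.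
In fact, we construct a sequence of disjoint intervals `Iⱼ := [½κⱼ, 2κⱼ]` with `κⱼ → 0` such that,
if `I = ∪_{j∈ℕ} Iⱼ`, then `inf_{κ ∈ I} κ‖∇θ^κ‖²_{L²((0,1)×T^d)} ≥ ϱ²‖θ₀‖²_{L²(T^d)}`"; `I` is the
set `K` of permissible diffusivities (3.43) p. 43, fixed in §5 before the datum, p. 82), for a
drift `u` and a sequence `κ : ℕ → ℝ`: every `κⱼ` is positive, `4κⱼ₊₁ < κⱼ` (lacunarity: the
closed intervals `Iⱼ` are pairwise disjoint and `κⱼ ↓ 0`, as printed), `κⱼ → 0`, and for every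
`R ≥ 0` there is a constant `c = c(R) > 0` (AV's `ϱ(d,θ₀)²`,
`ϱ = c(d,ε)(‖θ₀‖_{L²}/‖θ₀‖_{H¹})^{(1+α)/(1-α)+ε}` by (1.6), which is bounded below on the class
`‖∇θ₀‖²_{L²} ≤ R‖θ₀‖²_{L²}` since there `‖θ₀‖_{L²}/‖θ₀‖_{H¹} ≥ (1+R)^{-1/2}`) such that for every
`j`, every `κ ∈ [κⱼ/2, 2κⱼ]`, every mean-zero `θ₀ ∈ H¹(T^d)` with `‖∇θ₀‖²_{L²} ≤ R‖θ₀‖²_{L²}` and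
every weak solution `θ` of `∂ₜθ + u·∇θ = κΔθ`, `θ(0) = θ₀` on `T^d × [0,1)`:
`c‖θ₀‖²_{L²} ≤ κ ∫₀¹ ‖∇θ(t)‖²_{L²} dt` (`Torus.scalarL2Sq`, spectral `Torus.eScalarGradNormSq` and
`Torus.eScalarDissipation`, `H¹` via `Torus.MemSobolev 1` of the complexified scalar — the
conventions of `armstrong_vicol`; AV's `θ^κ` is the unique solution, so all weak solutions are
quantified, as there).
[cite: ArmstrongVicol2025, Thm. 1.1 (1.4), (1.6) and the remark following it, p. 3; (3.43) p. 43; §5.3 p. 82] -/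
def DissipatesAlongIntervals (u : ℝ → UnitAddTorus d → EuclideanSpace ℝ d) (κ : ℕ → ℝ) : Prop :=
  (∀ j, 0 < κ j) ∧ (∀ j, 4 * κ (j + 1) < κ j) ∧ Tendsto κ atTop (𝓝 0) ∧
    ∀ R : ℝ≥0, ∃ c : ℝ, 0 < c ∧ ∀ j, ∀ κ' ∈ Icc (κ j / 2) (2 * κ j),
      ∀ θ₀ : UnitAddTorus d → ℝ,
        FunctionSpaces.Torus.MemSobolev 1 (fun x => (θ₀ x : ℂ)) →
        FunctionSpaces.Torus.HasZeroMean θ₀ →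
        Torus.eScalarGradNormSq θ₀ ≤ (R : ℝ≥0∞) * ENNReal.ofReal (Torus.scalarL2Sq θ₀) →
        ∀ θ : ℝ → UnitAddTorus d → ℝ, Torus.IsWeakScalarTransportOn 1 κ' u θ₀ θ →
          ENNReal.ofReal (c * Torus.scalarL2Sq θ₀) ≤ Torus.eScalarDissipation κ' θ 0 1

/-- **Uniform-in-`κ` Hölder continuity in time of the scalar** (AV Remark 5.4 (5.108) p. 93,
announced on p. 3: "it yields a tiny exponent `μ > 0` depending only on `α` such that
`‖θ^{κⱼ}‖_{C^{0,μ}_t L²_x([0,1]×T^d)}` stays bounded along the subsequence `κⱼ ↓ 0`. The mapping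
`t ↦ ∫_{T^d} |θ^{κⱼ}(t,x)|² dx` is therefore uniformly continuous on `[0,1]`: see Remark 5.4. In
particular, the diffusive anomaly does not happen at any single 'blow-up time.'"; (5.108):
`‖θ‖_{C^{0,μ}([0,1];L²(T²))} ≤ C_{θ₀}`, "where `C_{θ₀}` depends only on `‖θ₀‖_{H¹(T²)}` and `β`",
`μ = μ(β) > 0` from Remark 5.3 (5.90) p. 89, for the permissible `κ ∈ K` fixed in §5, p. 82),
for a drift `u` and a sequence `κ : ℕ → ℝ`: there is `μ > 0` such that for every mean-zero
`θ₀ ∈ H¹(T^d)` there is `C` with — for every `j`, every `κ ∈ [κⱼ/2, 2κⱼ]` and every weak solution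
`θ` with diffusivity `κ` and datum `θ₀` on `T^d × [0,1)` lying in `C([0,1]; L²(T^d))` (AV's class
of "unique solutions `{θ^κ}_{κ>0} ∈ C([0,1]; L²(T^d))`", Thm. 1.1; the tree's weak solutions are
determined for a.e. `t` only, so the continuous representative is named: `θ(t) ∈ L²` for
`t ∈ [0,1]` and `‖θ(t) - θ(t₀)‖²_{L²} → 0` as `t → t₀` within `[0,1]`) —
`‖θ(t)‖²_{L²} ≤ C²` and `‖θ(t) - θ(s)‖²_{L²} ≤ C²|t-s|^{2μ}` for all `s, t ∈ [0,1]`.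
Recorded weakenings: `C = C(θ₀)` per datum (printed: depending on `‖θ₀‖_{H¹}` and `β` only);
`μ` may depend on the construction (printed: on `α` only). Recorded reading: (5.108) is derived
with the objects of the analytic-datum case (5.69) of the proof ((5.90), (5.92), (5.94), (5.101));
for general mean-zero `H¹` data the claim is the sentence on p. 3 and the stated dependence of
`C_{θ₀}`. [cite: ArmstrongVicol2025, Remark 5.4 (5.108) p. 93; Remark 5.3 (5.90) p. 89; p. 3 (remark after (1.6))] -/
def IsTimeHolderAlong (u : ℝ → UnitAddTorus d → EuclideanSpace ℝ d) (κ : ℕ → ℝ) : Prop :=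
  ∃ μ : ℝ≥0, 0 < μ ∧ ∀ θ₀ : UnitAddTorus d → ℝ,
    FunctionSpaces.Torus.MemSobolev 1 (fun x => (θ₀ x : ℂ)) →
    FunctionSpaces.Torus.HasZeroMean θ₀ →
    ∃ C : ℝ≥0, ∀ j, ∀ κ' ∈ Icc (κ j / 2) (2 * κ j), ∀ θ : ℝ → UnitAddTorus d → ℝ,
      Torus.IsWeakScalarTransportOn 1 κ' u θ₀ θ →
      (∀ t ∈ Icc (0 : ℝ) 1, MemLp (θ t) 2) →
      (∀ t₀ ∈ Icc (0 : ℝ) 1,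
        Tendsto (fun t => Torus.scalarL2Sq (θ t - θ t₀)) (𝓝[Icc 0 1] t₀) (𝓝 0)) →
      ∀ s ∈ Icc (0 : ℝ) 1, ∀ t ∈ Icc (0 : ℝ) 1,
        Torus.scalarL2Sq (θ t) ≤ (C : ℝ) ^ 2 ∧
        Torus.scalarL2Sq (θ t - θ s) ≤ (C : ℝ) ^ 2 * |t - s| ^ (2 * (μ : ℝ))

end ArmstrongVicol2025

/-- **turb.S22, printed form of Thm. 1.1** (Armstrong–Vicol, Ann. PDE 11 (2025) =
arXiv:2305.05048v3, Thm. 1.1 p. 3 with (1.2)–(1.4), (1.6) and the remark on the explicit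
intervals following (1.6); typed 2026-08-26 with the two printed clauses that `armstrong_vicol`
drops — see its docstring: "the extra `C^{0,α}_t C⁰_x` regularity is dropped", "only the centres
`κⱼ` of the intervals are kept here (weaker)").
Let `d ≥ 2` and `0 < α < 1/3`. There exist a carrier `u` of the class
`ArmstrongVicol2025.IsCarrier α` (`1`-periodic in time, `C⁰_t C^{0,α}_x ∩ C^{0,α}_t C⁰_x`, weakly
divergence free) and a lacunary sequence `κⱼ → 0` (`4κⱼ₊₁ < κⱼ`), neither depending on the
datum, with `ArmstrongVicol2025.DissipatesAlongIntervals u κ`: for every length-scale class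
`‖∇θ₀‖²_{L²} ≤ R‖θ₀‖²_{L²}` one constant `c > 0` with `c‖θ₀‖²_{L²} ≤ κ ∫₀¹ ‖∇θ‖²_{L²}` for every
`κ ∈ ⋃ⱼ [κⱼ/2, 2κⱼ]`, every mean-zero `H¹` datum of the class and every weak solution.
Source form: Thm. 1.1 — "Let `d ≥ 2` and `α ∈ (0,1/3)`. There exists a vector field
`b ∈ C⁰_t C^{0,α}_x([0,1]×T^d) ∩ C^{0,α}_t C⁰_x([0,1]×T^d)` which satisfies (1.2) such that, for
every mean-zero initial datum `θ₀ ∈ H¹(T^d)`, the family of unique solutions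
`{θ^κ}_{κ>0} ∈ C([0,1];L²(T^d))` of the advection-diffusion equation (1.1) satisfy
`limsup_{κ→0} κ‖∇θ^κ‖²_{L²((0,1)×T^d)} ≥ ϱ²‖θ₀‖²_{L²(T^d)}`, for some constant
`ϱ = ϱ(d,θ₀) ∈ (0,1]` which depends only on `d` and the ratio `‖θ₀‖_{L²(T^d)}/‖∇θ₀‖_{L²(T^d)}`" —
with (1.6) and the interval remark quoted in `ArmstrongVicol2025.DissipatesAlongIntervals`.
Recorded reading (as for `armstrong_vicol`): general `d ≥ 2` as printed, the proof being written
for `d = 2` ("only notational differences", §1.2); AV's lack-of-selection statement is NOT part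
of this fact (v3 p. 3: "at least for carefully chosen initial data"; Prop. 5.5 p. 93 concerns a
construction-dependent class of `Ḣ²(T²)` data and has no self-contained printed form).
`armstrong_vicol` follows (`κ = κⱼ ∈ Iⱼ`, period `τ = 1`): `armstrong_vicol_of_thm11_full` in
`TurbPassiveScalarProofs.lean`. [cite: ArmstrongVicol2025, Thm. 1.1 (1.2)–(1.4), (1.6) and the remarks following it, p. 3; (3.43) p. 43; §2.2 p. 23; Cor. 2.3 p. 29] -/
def ArmstrongVicol2025_thm11_full : Prop :=
  ∀ (hd : 2 ≤ Fintype.card d) (α : ℝ≥0) (hα₀ : 0 < α) (hα : α < 1 / 3),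
    ∃ u : ℝ → UnitAddTorus d → EuclideanSpace ℝ d, ArmstrongVicol2025.IsCarrier α u ∧
      ∃ κ : ℕ → ℝ, ArmstrongVicol2025.DissipatesAlongIntervals u κ

/-- **turb.S22, Remark 5.4** (Armstrong–Vicol, Ann. PDE 11 (2025) = arXiv:2305.05048v3,
Remark 5.4 "Uniform continuity in time of the scalar variance", (5.108) p. 93, with the sentence
announcing it on p. 3). With `d`, `α`, the carrier `u` and the intervals `[κⱼ/2, 2κⱼ]` of
Thm. 1.1 (`ArmstrongVicol2025_thm11_full`, whose clauses are repeated so that the SAME `u`, `κ`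
carry both properties): the solutions `θ^κ`, `κ ∈ ⋃ⱼ [κⱼ/2, 2κⱼ]`, of every mean-zero `H¹` datum
are bounded in `C^{0,μ}([0,1]; L²(T^d))` uniformly in `κ`, for one `μ = μ(α) > 0`
(`ArmstrongVicol2025.IsTimeHolderAlong u κ`, where the printed statement, the typed reading and
the recorded weakenings are quoted) — "the diffusive anomaly does not happen at any single
blow-up time" (p. 3). Kept apart from `ArmstrongVicol2025_thm11_full` because it is a remark with
a proof sketch ("By using (5.90) and repeating the argument of Remark 5.3 …") rather than part of
the theorem; `ArmstrongVicol2025_thm11_full` is its corollary (`thm11_full_of_rmk54` in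
`TurbPassiveScalarProofs.lean`). [cite: ArmstrongVicol2025, Remark 5.4 (5.108) p. 93; Thm. 1.1 and the remarks following (1.6), p. 3] -/
def ArmstrongVicol2025_rmk54 : Prop :=
  ∀ (hd : 2 ≤ Fintype.card d) (α : ℝ≥0) (hα₀ : 0 < α) (hα : α < 1 / 3),
    ∃ u : ℝ → UnitAddTorus d → EuclideanSpace ℝ d, ArmstrongVicol2025.IsCarrier α u ∧
      ∃ κ : ℕ → ℝ, ArmstrongVicol2025.DissipatesAlongIntervals u κ ∧
        ArmstrongVicol2025.IsTimeHolderAlong u κ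

/-! ## Armstrong–Vicol, the explicit dissipation rate (1.6) (2026-08-26)

The clause predicate `ArmstrongVicol2025.DissipatesAtRate p u κ` spells out (1.6) of
Armstrong–Vicol (Ann. PDE 11 (2025) = arXiv:2305.05048v3, p. 3): along the intervals
`[κⱼ/2, 2κⱼ]` the dissipated fraction of the variance is at least `ϱ²` with
`ϱ = c L_{θ₀}^p`, `L_{θ₀} = ‖θ₀‖_{L²}/‖θ₀‖_{H¹}` ((5.103) p. 92), ONE `c > 0` for all data; the fact
`ArmstrongVicol2025_thm11_rate` asserts it with the printed exponent `p = (1+α)/(1-α) + ε`,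
`ε > 0` arbitrary. The class-uniform clause `ArmstrongVicol2025.DissipatesAlongIntervals`
(`∀ R, ∃ c(R)`) is its corollary (`ArmstrongVicol2025.DissipatesAtRate.dissipatesAlongIntervals`
in `TurbPassiveScalarProofs.lean`), which is the printed sentence "In particular, `ϱ(d,θ₀)`
depends only on `d` and a lower bound for the length scale `‖θ₀‖_{L²}/‖∇θ₀‖_{L²}`" (p. 3). -/

namespace ArmstrongVicol2025

/-- **The explicit rate (1.6) of AV Thm. 1.1 along the intervals `Iⱼ = [κⱼ/2, 2κⱼ]`**, for an
exponent `p`, a drift `u` and a sequence `κ : ℕ → ℝ` (Armstrong–Vicol, Ann. PDE 11 (2025) =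
arXiv:2305.05048v3, p. 3: "As we will see in the proof, the parameter `ϱ > 0` in Theorem 1.1 can
be taken to be `ϱ(d,θ₀) = c (‖θ₀‖_{L²(T^d)} / ‖θ₀‖_{H¹(T^d)})^{(1+α)/(1-α)+ε}` (1.6), where
`ε > 0` is any positive constant, and `c = c(d,ε) > 0` is a positive constant."; the bound of
Thm. 1.1 being `ϱ² ‖θ₀‖²_{L²}` for every `κ ∈ I = ⋃ⱼ Iⱼ`, remark following (1.6), p. 3; proof:
§5.4 pp. 91–93, the length scale `L_{θ₀} := ‖θ₀‖_{L²(T²)}/‖θ₀‖_{H¹(T²)}` of (5.103) p. 92 and the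
final display of the proof, `κ^{1/2} ‖∇θ‖_{L²((0,1)×T²)} ≥ c L_{θ₀}^{q(β+γ)/(2+γ-q(β+γ))} ‖θ₀‖_{L²}`,
p. 93): there is ONE constant `c > 0` such that for every `j`, every `κ' ∈ [κⱼ/2, 2κⱼ]`, every
mean-zero `θ₀ ∈ H¹(T^d)` with length scale `ℓ = ‖θ₀‖_{L²}/‖∇θ₀‖_{L²}` (the identity
`‖θ₀‖²_{L²} = ℓ² ‖∇θ₀‖²_{L²}` in `ℝ≥0∞`, spectral `Torus.eScalarGradNormSq`, as in
`BurczakSzekelyhidiWu2023_richardsonBound`) and every weak solution `θ` of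
`∂ₜθ + u·∇θ = κ'Δθ`, `θ(0) = θ₀` on `T^d × [0,1)`:
`c² (L²)^p ‖θ₀‖²_{L²} ≤ κ' ∫₀¹ ‖∇θ(t)‖²_{L²} dt` with `L² = ℓ²/(1+ℓ²)`, i.e. `ϱ = c L^p`,
`L = ‖θ₀‖_{L²}/‖θ₀‖_{H¹}` for the norm `‖θ₀‖²_{H¹} = ‖θ₀‖²_{L²} + ‖∇θ₀‖²_{L²}` (real power
`Real.rpow`; the conventions of `DissipatesAlongIntervals` otherwise).
Recorded reading: AV fix no normalisation of `‖·‖_{H¹(T^d)}` (§1.4 p. 15); any equivalent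
normalisation (e.g. the tree's spectral `Torus.eSobolevNorm 1`, weight `1+|k|²` against the `4π²|k|²`
of `‖∇θ₀‖²`) changes `L` by a factor in a fixed compact subinterval of `(0,∞)` and hence only the
constant `c`, which is existential here. [cite: ArmstrongVicol2025, eq. (1.6) and the remark following it, p. 3; (5.103) p. 92; proof of Thm. 1.1, §5.4 pp. 91–93] -/
def DissipatesAtRate (p : ℝ) (u : ℝ → UnitAddTorus d → EuclideanSpace ℝ d) (κ : ℕ → ℝ) : Prop :=
  ∃ c : ℝ, 0 < c ∧ ∀ j, ∀ κ' ∈ Icc (κ j / 2) (2 * κ j),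
    ∀ θ₀ : UnitAddTorus d → ℝ,
      FunctionSpaces.Torus.MemSobolev 1 (fun x => (θ₀ x : ℂ)) →
      FunctionSpaces.Torus.HasZeroMean θ₀ →
      ∀ ℓ : ℝ, 0 < ℓ →
        ENNReal.ofReal (Torus.scalarL2Sq θ₀) = ENNReal.ofReal (ℓ ^ 2) * Torus.eScalarGradNormSq θ₀ →
        ∀ θ : ℝ → UnitAddTorus d → ℝ, Torus.IsWeakScalarTransportOn 1 κ' u θ₀ θ →
          ENNReal.ofReal (c ^ 2 * (ℓ ^ 2 / (1 + ℓ ^ 2)) ^ p * Torus.scalarL2Sq θ₀) ≤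
            Torus.eScalarDissipation κ' θ 0 1

end ArmstrongVicol2025

/-- **turb.S22, Thm. 1.1 with the explicit rate (1.6)** (Armstrong–Vicol, Ann. PDE 11 (2025) =
arXiv:2305.05048v3, Thm. 1.1 p. 3 with (1.6) and the remarks following it; proof §5.4
pp. 91–93). Let `d ≥ 2`, `0 < α < 1/3` and `ε > 0`. There exist a carrier `u` of the class
`ArmstrongVicol2025.IsCarrier α` and a lacunary datum-independent sequence `κⱼ → 0` with
`ArmstrongVicol2025.DissipatesAlongIntervals u κ` (the conclusion of Thm. 1.1 for every
`κ ∈ ⋃ⱼ [κⱼ/2, 2κⱼ]`) AND the explicit rate `ArmstrongVicol2025.DissipatesAtRate ((1+α)/(1-α)+ε) u κ`: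
one `c = c(d,ε,·) > 0` with `ϱ = c (‖θ₀‖_{L²}/‖θ₀‖_{H¹})^{(1+α)/(1-α)+ε}` for ALL mean-zero `H¹`
data. Source form: "As we will see in the proof, the parameter `ϱ > 0` in Theorem 1.1 can be taken
to be `ϱ(d,θ₀) = c (‖θ₀‖_{L²(T^d)}/‖θ₀‖_{H¹(T^d)})^{(1+α)/(1-α)+ε}` (1.6), where `ε > 0` is any
positive constant, and `c = c(d,ε) > 0` is a positive constant. In particular, `ϱ(d,θ₀)` depends
only on `d` and a lower bound for the length scale `‖θ₀‖_{L²(T^d)}/‖∇θ₀‖_{L²(T^d)}`." (p. 3).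
Recorded readings (weakenings): (i) the quantifier order `∀ ε, ∃ u, κ, c` — the proof (p. 93:
"the exponent of `L_{θ₀}`, namely `q(β+γ)/(2+γ-q(β+γ))`, can be taken arbitrarily close to
`β/(2-β)`, by taking `q` closer to `1` than in (2.2), at the cost of all constants depending
additionally on `q`. With `α = β-1`, this matches what was promised in (1.6)"; `β/(2-β) =
(1+α)/(1-α)`) reaches the exponent `(1+α)/(1-α)+ε` by choosing the scale-separation parameter `q`
of (2.2) p. 18, on which the construction of `b` ((2.10)) and the intervals (3.43) depend, so the
carrier serving a given `ε` is `b = b_{α,q(ε)}` — Thm. 1.1 asserts the existence of `b` only, and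
the typed order is the one proved; (ii) `c` existential after `α` and `ε` (printed `c(d,ε)`);
(iii) general `d ≥ 2` as printed, proof written for `d = 2` (§1.2), as for `armstrong_vicol`;
(iv) `ϱ ∈ (0,1]` not transcribed. `ArmstrongVicol2025_thm11_full` follows (`ε = 1`, drop the
rate clause) and the rate clause alone implies the class-uniform clause of
`DissipatesAlongIntervals` (`thm11_full_of_thm11_rate`,
`ArmstrongVicol2025.DissipatesAtRate.dissipatesAlongIntervals` in `TurbPassiveScalarProofs.lean`).
[cite: ArmstrongVicol2025, Thm. 1.1 with eq. (1.6) and the remarks following it, p. 3; (2.2) p. 18; (3.43) p. 43; (5.103) p. 92; §5.4 p. 93] -/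
def ArmstrongVicol2025_thm11_rate : Prop :=
  ∀ (hd : 2 ≤ Fintype.card d) (α : ℝ≥0) (hα₀ : 0 < α) (hα : α < 1 / 3) (ε : ℝ) (hε : 0 < ε),
    ∃ u : ℝ → UnitAddTorus d → EuclideanSpace ℝ d, ArmstrongVicol2025.IsCarrier α u ∧
      ∃ κ : ℕ → ℝ, ArmstrongVicol2025.DissipatesAlongIntervals u κ ∧
        ArmstrongVicol2025.DissipatesAtRate ((1 + (α : ℝ)) / (1 - α) + ε) u κ

end Literature.Analysis.FluidPDE
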